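import Summits.RiemannHypothesis.RiemannHypothesis.Theses.EvenSectorBarta
import Summits.RiemannHypothesis.RiemannHypothesis.Theorems.GroundBartaPolarPerronFrobeniusEvenSectorNegativity
import HarnessLib

/-!
# Route `EvenSectorBarta`, item `EvenNegativityOffLine` (stmt-RiemannHypothesis-19956) — closed

If RH fails there are `η > 0` and `A` such that every window `a ≥ A` carries an even
`L²`-normalised smooth test `h` supported in `[-a, a]` with `Re Q h ≤ -η`: the in-tree even Weil
criterion (`RuelleBandExactFirstBand.riemannHypothesis_iff_evenWeilPositivity`) in contrapositive,
normalised, window-uniform form — `PolarPerronFrobenius.evenNegativityOffLine` /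
`evenNegativityOffLine_routeForm` (route GroundBarta,
Theorems/GroundBartaPolarPerronFrobeniusEvenSectorNegativity.lean).  References: Yoshida 1992 Prop. 1;
Bombieri 2000 §5.
-/

set_option linter.dupNamespace false

namespace Summit.RiemannHypothesis.RiemannHypothesis.Theorems.EvenSectorBarta

/-- **Item `EvenNegativityOffLine` (stmt-RiemannHypothesis-19956)**: even negativity off the line,
window-uniform. [cite: Yoshida1992HermitianForms, Prop. 1] -/
theorem evenNegativityOffLine_proof :
    Summit.RiemannHypothesis.RiemannHypothesis.Theses.EvenSectorBarta.EvenNegativityOffLine :=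
  Summit.RiemannHypothesis.RiemannHypothesis.Theorems.PolarPerronFrobenius.evenNegativityOffLine_routeForm

end Summit.RiemannHypothesis.RiemannHypothesis.Theorems.EvenSectorBarta
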